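import Summits.CriticalPhenomena.PercolationContinuityZ3.Theorems.PercNearOneGluingNoHeavyLowerTailKnQuestion8CoefficientwiseCoreClassKernelMixBundleClassChain
import HarnessLib

/-!
# Boundary inequality on bundles, XVII: the per-class count of THEOREM CT (every class of every thread pays for its own sources)

Support file (`--supports stmt-CriticalPhenomena-4575`, closed), prover `prim-cplus-coupling` (gen 59).  No definitions, no notations, no named facts,
no sorries; standard axioms.  Memo `prim-cplus-coupling/A5-COUPLING-gen59.md` §1.

On an explicit bundle whose threads are exactly `z, p, q`, for EVERY up-closed event `𝒱`, all monotone 0/1 levels and every red-prefix class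
`R_a(z)` (`1 ≤ a ≤ L z − 1`):
* `Coefficientwise.bundle_class_count`: `#bad₁(𝒱 ∩ R_a(z)) + #bad₂(𝒱 ∩ R_a(z)) ≤ #(L₁ ∪ L₂)(𝒱 ∩ R_a(z))`.
PROOF.  A demand point of the class has `p` or `q` blue (`z` is not blue); by the chain lemma in the class (`bundle_class_chain`) a type-1 and a type-2
source of the class cannot both fail to start red on the same thread, so either the class is single-type — then the merged scheme in the class
(`bundle_class_merged_count`) pays — or all type-1 sources sit on one face starting red on the other non-`z` thread and all type-2 sources on the other
face (`bundle_class_two_type_count`).  In coordinates the class is the HAIRY CYCLE `cycle(p,q) + pendant path at b` with `X`-levels shifted by `I_z(a)`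
(memo §1, remark (a)).  [cite: KozmaNitzan2024, Questions 8–9 (§5.5 p. 36) (context); Harris 1960]
-/

namespace Summit.CriticalPhenomena.PercolationContinuityZ3.Theorems

open Finset Literature.Probability.Percolation

namespace Coefficientwise

variable {ι V : Type*}

open Classical in
/-- **Per-class count (three threads, all 0/1 levels, every up-set).**  Explicit bundle whose threads are exactly `z, p, q`; class `R_a(z)`.  Then
`#bad₁(𝒱 ∩ R_a(z)) + #bad₂(𝒱 ∩ R_a(z)) ≤ #(L₁ ∪ L₂)(𝒱 ∩ R_a(z))`: by the chain lemma in the class each face carries one type, so the class is either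
single-type (merged scheme in the class) or of the two-type form of `bundle_class_two_type_count`.  Memo gen 59 §1.
[cite: KozmaNitzan2024, Questions 8–9 (§5.5 p. 36) (context); Harris 1960] -/
theorem bundle_class_count (ends : ι → Sym2 V) (r : ℕ) (L : ℕ → ℕ) (hL : ∀ t, t < r → 1 ≤ L t)
    (w : ℕ → ℕ → V) (e : ℕ → ℕ → ι) (u b : V)
    (hw0 : ∀ t, t < r → w t 0 = u) (hwL : ∀ t, t < r → w t (L t) = b)
    (harc : ∀ t, t < r → ∀ j, 1 ≤ j → j ≤ L t → ends (e t j) = s(w t (j - 1), w t j))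
    (hwinj : ∀ t, t < r → ∀ i j, i ≤ L t → j ≤ L t → w t i = w t j → i = j)
    (hcross : ∀ t t', t < r → t' < r → t ≠ t' → ∀ i j, i ≤ L t → j ≤ L t' → w t i = w t' j → (i = 0 ∧ j = 0) ∨ (i = L t ∧ j = L t'))
    (A : ℕ → Finset ι) (hA : ∀ t, t < r → ∀ i, i ∈ A t ↔ ∃ j, 1 ≤ j ∧ j ≤ L t ∧ e t j = i)
    (hAdisj : ∀ t t', t < r → t' < r → t ≠ t' → Disjoint (A t) (A t'))
    (E : Finset ι) (hEA : ∀ i, i ∈ E ↔ ∃ t, t < r ∧ i ∈ A t)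
    (z p q : ℕ) (hz : z < r) (hp : p < r) (hq : q < r) (hzp : z ≠ p) (hzq : z ≠ q) (hpq : p ≠ q)
    (hr3 : ∀ t, t < r → t = z ∨ t = p ∨ t = q) (a : ℕ) (ha1 : 1 ≤ a) (haL : a + 1 ≤ L z)
    (𝒱 : Finset ι → Prop) (hV : ∀ ⦃s t : Finset ι⦄, s ⊆ t → 𝒱 s → 𝒱 t)
    (ha hb ka kb : Set V → ℝ) (mha : Monotone ha) (mhb : Monotone hb) (mka : Monotone ka) (mkb : Monotone kb)
    (ha01 : ∀ S, ha S = 0 ∨ ha S = 1) (hb01 : ∀ S, hb S = 0 ∨ hb S = 1) (ka01 : ∀ S, ka S = 0 ∨ ka S = 1) (kb01 : ∀ S, kb S = 0 ∨ kb S = 1) :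
    ((E.powerset).filter (fun σ => ((∀ j, 1 ≤ j → j ≤ a → e z j ∈ σ) ∧ e z (a + 1) ∉ σ) ∧ 𝒱 σ ∧
        (b ∈ openCluster (ends '' (↑(E \ σ) : Set ι)) u ∧ b ∉ openCluster (ends '' (↑σ : Set ι)) u) ∧
        (ha (openCluster (ends '' (↑σ : Set ι)) u) = 1 ∧ hb (openCluster (ends '' (↑(E \ σ) : Set ι)) u) = 0) ∧
        (kb (openCluster (ends '' (↑(E \ σ) : Set ι)) u) = 1 ∧ ka (openCluster (ends '' (↑σ : Set ι)) u) = 0))).card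
    + ((E.powerset).filter (fun σ => ((∀ j, 1 ≤ j → j ≤ a → e z j ∈ σ) ∧ e z (a + 1) ∉ σ) ∧ 𝒱 σ ∧
        (b ∈ openCluster (ends '' (↑(E \ σ) : Set ι)) u ∧ b ∉ openCluster (ends '' (↑σ : Set ι)) u) ∧
        (ka (openCluster (ends '' (↑σ : Set ι)) u) = 1 ∧ kb (openCluster (ends '' (↑(E \ σ) : Set ι)) u) = 0) ∧
        (hb (openCluster (ends '' (↑(E \ σ) : Set ι)) u) = 1 ∧ ha (openCluster (ends '' (↑σ : Set ι)) u) = 0))).card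
    ≤ ((E.powerset).filter (fun lam => ((∀ j, 1 ≤ j → j ≤ a → e z j ∈ lam) ∧ e z (a + 1) ∉ lam) ∧ 𝒱 lam ∧
        (b ∈ openCluster (ends '' (↑lam : Set ι)) u ∧ b ∉ openCluster (ends '' (↑(E \ lam) : Set ι)) u) ∧
        ((ha (openCluster (ends '' (↑lam : Set ι)) u) = 1 ∧ kb (openCluster (ends '' (↑lam : Set ι)) u) = 1 ∧
            hb (openCluster (ends '' (↑(E \ lam) : Set ι)) u) = 0 ∧ ka (openCluster (ends '' (↑(E \ lam) : Set ι)) u) = 0) ∨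
          (ka (openCluster (ends '' (↑lam : Set ι)) u) = 1 ∧ hb (openCluster (ends '' (↑lam : Set ι)) u) = 1 ∧
            kb (openCluster (ends '' (↑(E \ lam) : Set ι)) u) = 0 ∧ ha (openCluster (ends '' (↑(E \ lam) : Set ι)) u) = 0)))).card := by
  set C : Finset ι → Set V := fun ω => openCluster (ends '' (↑ω : Set ι)) u with hC
  have hr : 0 < r := lt_of_le_of_lt (Nat.zero_le z) hz
  have hAE : ∀ t, t < r → A t ⊆ E := fun t ht i hi => (hEA i).mpr ⟨t, ht, hi⟩
  have heA : ∀ t, t < r → ∀ j, 1 ≤ j → j ≤ L t → e t j ∈ A t := fun t ht j hj1 hjL => (hA t ht _).mpr ⟨j, hj1, hjL, rfl⟩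
  have hE : ∀ i, i ∈ E → ∃ t, t < r ∧ ∃ j, 1 ≤ j ∧ j ≤ L t ∧ e t j = i := fun i hi => by
    obtain ⟨t, ht, hit⟩ := (hEA i).mp hi; exact ⟨t, ht, (hA t ht i).mp hit⟩
  have full_iff : ∀ ω : Finset ι, ω ⊆ E → (b ∈ C ω ↔ ∃ t, t < r ∧ A t ⊆ ω) := fun ω hω =>
    bundle_b_mem_cluster_iff_threads ends r L hL w e u b hr hw0 hwL harc hwinj hcross A hA E hEA ω hω
  have one_of_ge : ∀ (f : Set V → ℝ), (∀ S, f S = 0 ∨ f S = 1) → ∀ S S' : Set V, S ⊆ S' → Monotone f → f S = 1 → f S' = 1 := by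
    intro f f01 S S' hSS' mf h1
    rcases f01 S' with h0 | h0
    · have := mf hSS'; rw [h1, h0] at this; linarith
    · exact h0
  have nofull : ∀ σ : Finset ι, σ ⊆ E → b ∉ C σ → ∀ t, t < r → ∃ j, 1 ≤ j ∧ j ≤ L t ∧ e t j ∉ σ := by
    intro σ hσ hb' t ht
    by_contra hno
    push Not at hno
    exact hb' ((full_iff σ hσ).mpr ⟨t, ht, fun x hx => by
      obtain ⟨j, hj1, hjL, rfl⟩ := (hA t ht x).mp hx
      exact hno j hj1 hjL⟩)
  -- ## a demand point of the class has `p` or `q` blue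
  have face : ∀ σ : Finset ι, σ ⊆ E → ((∀ j, 1 ≤ j → j ≤ a → e z j ∈ σ) ∧ e z (a + 1) ∉ σ) → (b ∈ C (E \ σ) ∧ b ∉ C σ) →
      Disjoint (A p) σ ∨ Disjoint (A q) σ := by
    intro σ hσ hcl hN
    obtain ⟨t, ht, hsub⟩ := (full_iff (E \ σ) Finset.sdiff_subset).mp hN.1
    have hd : Disjoint (A t) σ := Finset.disjoint_left.mpr fun x hx hxσ => (Finset.mem_sdiff.mp (hsub hx)).2 hxσ
    rcases hr3 t ht with rfl | rfl | rfl
    · exact absurd (hcl.1 1 (le_refl 1) ha1) (Finset.disjoint_left.mp hd (heA t ht 1 (le_refl 1) (hL t ht)))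
    · exact Or.inl hd
    · exact Or.inr hd
  have notstart : ∀ (σ : Finset ι) (t : ℕ), t < r → Disjoint (A t) σ → e t 1 ∉ σ :=
    fun σ t ht hd hm => Finset.disjoint_left.mp hd (heA t ht 1 (le_refl 1) (hL t ht)) hm
  -- ## the chain lemma: a type-1 and a type-2 source of the class cannot both fail to start red on the same thread `x ∈ {p, q}`
  have claim : ∀ x o : ℕ, x < r → o < r → x ≠ z → o ≠ z → x ≠ o → (∀ t, t < r → t = z ∨ t = x ∨ t = o) →
      ∀ τ₁ τ₂ : Finset ι, τ₁ ⊆ E → τ₂ ⊆ E →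
      ((∀ j, 1 ≤ j → j ≤ a → e z j ∈ τ₁) ∧ e z (a + 1) ∉ τ₁) → ((∀ j, 1 ≤ j → j ≤ a → e z j ∈ τ₂) ∧ e z (a + 1) ∉ τ₂) →
      (𝒱 τ₁ ∧ (b ∈ C (E \ τ₁) ∧ b ∉ C τ₁) ∧ (ha (C τ₁) = 1 ∧ hb (C (E \ τ₁)) = 0) ∧ (kb (C (E \ τ₁)) = 1 ∧ ka (C τ₁) = 0)) →
      (𝒱 τ₂ ∧ (b ∈ C (E \ τ₂) ∧ b ∉ C τ₂) ∧ (ka (C τ₂) = 1 ∧ kb (C (E \ τ₂)) = 0) ∧ (hb (C (E \ τ₂)) = 1 ∧ ha (C τ₂) = 0)) →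
      e x 1 ∉ τ₁ → e x 1 ∉ τ₂ → False := by
    intro x o hx ho hxz hoz hxo hr3' τ₁ τ₂ h1E h2E hcl1 hcl2 hs1 hs2 hn1 hn2
    have hst1 : ∀ t, t < r → t ≠ z → t ≠ o → e t 1 ∉ τ₁ := by
      intro t ht htz hto
      rcases hr3' t ht with rfl | rfl | rfl
      · exact absurd rfl htz
      · exact hn1
      · exact absurd rfl hto
    have hst2 : ∀ t, t < r → t ≠ z → t ≠ o → e t 1 ∉ τ₂ := by
      intro t ht htz hto
      rcases hr3' t ht with rfl | rfl | rfl
      · exact absurd rfl htz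
      · exact hn2
      · exact absurd rfl hto
    have hcmp := bundle_class_chain ends r L w e u hw0 harc hwinj hcross E hE z o a τ₁ τ₂ h1E h2E
      (nofull τ₁ h1E hs1.2.1.2) (nofull τ₂ h2E hs2.2.1.2) hcl1 hcl2 hst1 hst2
    rcases hcmp with hsub | hsub
    · have h0 := hs2.2.2.2.2
      rw [one_of_ge ha ha01 _ _ hsub mha hs1.2.2.1.1] at h0; exact one_ne_zero h0
    · have h0 := hs1.2.2.2.2
      rw [one_of_ge ka ka01 _ _ hsub mka hs2.2.2.1.1] at h0; exact one_ne_zero h0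
  have hr3' : ∀ t, t < r → t = z ∨ t = q ∨ t = p :=
    fun t ht => (hr3 t ht).elim Or.inl fun h => h.elim (fun h => Or.inr (Or.inr h)) fun h => Or.inr (Or.inl h)
  -- single-type targets are targets
  have subL₁ : (E.powerset).filter (fun lam => ((∀ j, 1 ≤ j → j ≤ a → e z j ∈ lam) ∧ e z (a + 1) ∉ lam) ∧ 𝒱 lam ∧
      (b ∈ C lam ∧ b ∉ C (E \ lam)) ∧ (ha (C lam) = 1 ∧ kb (C lam) = 1 ∧ hb (C (E \ lam)) = 0 ∧ ka (C (E \ lam)) = 0)) ⊆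
      (E.powerset).filter (fun lam => ((∀ j, 1 ≤ j → j ≤ a → e z j ∈ lam) ∧ e z (a + 1) ∉ lam) ∧ 𝒱 lam ∧
      (b ∈ C lam ∧ b ∉ C (E \ lam)) ∧ ((ha (C lam) = 1 ∧ kb (C lam) = 1 ∧ hb (C (E \ lam)) = 0 ∧ ka (C (E \ lam)) = 0) ∨
        (ka (C lam) = 1 ∧ hb (C lam) = 1 ∧ kb (C (E \ lam)) = 0 ∧ ha (C (E \ lam)) = 0))) := by
    intro lam hlam
    rw [Finset.mem_filter] at hlam ⊢
    exact ⟨hlam.1, hlam.2.1, hlam.2.2.1, hlam.2.2.2.1, Or.inl hlam.2.2.2.2⟩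
  have subL₂ : (E.powerset).filter (fun lam => ((∀ j, 1 ≤ j → j ≤ a → e z j ∈ lam) ∧ e z (a + 1) ∉ lam) ∧ 𝒱 lam ∧
      (b ∈ C lam ∧ b ∉ C (E \ lam)) ∧ (ka (C lam) = 1 ∧ hb (C lam) = 1 ∧ kb (C (E \ lam)) = 0 ∧ ha (C (E \ lam)) = 0)) ⊆
      (E.powerset).filter (fun lam => ((∀ j, 1 ≤ j → j ≤ a → e z j ∈ lam) ∧ e z (a + 1) ∉ lam) ∧ 𝒱 lam ∧
      (b ∈ C lam ∧ b ∉ C (E \ lam)) ∧ ((ha (C lam) = 1 ∧ kb (C lam) = 1 ∧ hb (C (E \ lam)) = 0 ∧ ka (C (E \ lam)) = 0) ∨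
        (ka (C lam) = 1 ∧ hb (C lam) = 1 ∧ kb (C (E \ lam)) = 0 ∧ ha (C (E \ lam)) = 0))) := by
    intro lam hlam
    rw [Finset.mem_filter] at hlam ⊢
    exact ⟨hlam.1, hlam.2.1, hlam.2.2.1, hlam.2.2.2.1, Or.inr hlam.2.2.2.2⟩
  have cL₁ := Finset.card_le_card subL₁
  have cL₂ := Finset.card_le_card subL₂
  -- the merged schemes in the class (single-type classes)
  have m₁ := bundle_class_merged_count ends r L hL w e u b hw0 hwL harc hwinj hcross A hA hAdisj E hEA z p hz hp hzp a ha1 haL 𝒱 hV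
    ha hb ka kb mha mhb mka mkb ha01 hb01 ka01 kb01
  have m₂ := bundle_class_merged_count ends r L hL w e u b hw0 hwL harc hwinj hcross A hA hAdisj E hEA z p hz hp hzp a ha1 haL 𝒱 hV
    ka kb ha hb mka mkb mha mhb ka01 kb01 ha01 hb01
  have m₁' : ((E.powerset).filter (fun σ => ((∀ j, 1 ≤ j → j ≤ a → e z j ∈ σ) ∧ e z (a + 1) ∉ σ) ∧ 𝒱 σ ∧ (b ∈ C (E \ σ) ∧ b ∉ C σ) ∧
      (ha (C σ) = 1 ∧ hb (C (E \ σ)) = 0) ∧ (kb (C (E \ σ)) = 1 ∧ ka (C σ) = 0))).card ≤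
      ((E.powerset).filter (fun lam => ((∀ j, 1 ≤ j → j ≤ a → e z j ∈ lam) ∧ e z (a + 1) ∉ lam) ∧ 𝒱 lam ∧
      (b ∈ C lam ∧ b ∉ C (E \ lam)) ∧ (ha (C lam) = 1 ∧ kb (C lam) = 1 ∧ hb (C (E \ lam)) = 0 ∧ ka (C (E \ lam)) = 0))).card := by
    convert m₁ using 3
  have m₂' : ((E.powerset).filter (fun σ => ((∀ j, 1 ≤ j → j ≤ a → e z j ∈ σ) ∧ e z (a + 1) ∉ σ) ∧ 𝒱 σ ∧ (b ∈ C (E \ σ) ∧ b ∉ C σ) ∧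
      (ka (C σ) = 1 ∧ kb (C (E \ σ)) = 0) ∧ (hb (C (E \ σ)) = 1 ∧ ha (C σ) = 0))).card ≤
      ((E.powerset).filter (fun lam => ((∀ j, 1 ≤ j → j ≤ a → e z j ∈ lam) ∧ e z (a + 1) ∉ lam) ∧ 𝒱 lam ∧
      (b ∈ C lam ∧ b ∉ C (E \ lam)) ∧ (ka (C lam) = 1 ∧ hb (C lam) = 1 ∧ kb (C (E \ lam)) = 0 ∧ ha (C (E \ lam)) = 0))).card := by
    convert m₂ using 3
  by_cases h1 : ∃ σ₁, σ₁ ⊆ E ∧ ((∀ j, 1 ≤ j → j ≤ a → e z j ∈ σ₁) ∧ e z (a + 1) ∉ σ₁) ∧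
      (𝒱 σ₁ ∧ (b ∈ C (E \ σ₁) ∧ b ∉ C σ₁) ∧ (ha (C σ₁) = 1 ∧ hb (C (E \ σ₁)) = 0) ∧ (kb (C (E \ σ₁)) = 1 ∧ ka (C σ₁) = 0))
  · by_cases h2 : ∃ σ₂, σ₂ ⊆ E ∧ ((∀ j, 1 ≤ j → j ≤ a → e z j ∈ σ₂) ∧ e z (a + 1) ∉ σ₂) ∧
        (𝒱 σ₂ ∧ (b ∈ C (E \ σ₂) ∧ b ∉ C σ₂) ∧ (ka (C σ₂) = 1 ∧ kb (C (E \ σ₂)) = 0) ∧ (hb (C (E \ σ₂)) = 1 ∧ ha (C σ₂) = 0))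
    · -- ## two-type class
      obtain ⟨σ₁, h1E, hcl1, hs1⟩ := h1
      obtain ⟨σ₂, h2E, hcl2, hs2⟩ := h2
      by_cases hA1 : e p 1 ∈ σ₁
      · -- type 1 starts red on p: type 1 has q blue, type 2 has p blue and starts red on q
        have hdq1 : Disjoint (A q) σ₁ := (face σ₁ h1E hcl1 hs1.2.1).resolve_left fun hd => notstart σ₁ p hp hd hA1
        have hT₂ : ∀ τ, τ ⊆ E → ((∀ j, 1 ≤ j → j ≤ a → e z j ∈ τ) ∧ e z (a + 1) ∉ τ) →
            (𝒱 τ ∧ (b ∈ C (E \ τ) ∧ b ∉ C τ) ∧ (ka (C τ) = 1 ∧ kb (C (E \ τ)) = 0) ∧ (hb (C (E \ τ)) = 1 ∧ ha (C τ) = 0)) →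
            Disjoint (A p) τ ∧ e q 1 ∈ τ := by
          intro τ hτ hclτ hsτ
          have hq1 : e q 1 ∈ τ := by
            by_contra hn
            exact claim q p hq hp hzq.symm hzp.symm hpq.symm hr3' σ₁ τ h1E hτ hcl1 hclτ hs1 hsτ (notstart σ₁ q hq hdq1) hn
          exact ⟨(face τ hτ hclτ hsτ.2.1).resolve_right fun hd => notstart τ q hq hd hq1, hq1⟩
        have hT₁ : ∀ τ, τ ⊆ E → ((∀ j, 1 ≤ j → j ≤ a → e z j ∈ τ) ∧ e z (a + 1) ∉ τ) →
            (𝒱 τ ∧ (b ∈ C (E \ τ) ∧ b ∉ C τ) ∧ (ha (C τ) = 1 ∧ hb (C (E \ τ)) = 0) ∧ (kb (C (E \ τ)) = 1 ∧ ka (C τ) = 0)) →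
            Disjoint (A q) τ ∧ e p 1 ∈ τ := by
          intro τ hτ hclτ hsτ
          have hp1 : e p 1 ∈ τ := by
            by_contra hn
            exact claim p q hp hq hzp.symm hzq.symm hpq hr3 τ σ₂ hτ h2E hclτ hcl2 hsτ hs2 hn (notstart σ₂ p hp (hT₂ σ₂ h2E hcl2 hs2).1)
          exact ⟨(face τ hτ hclτ hsτ.2.1).resolve_left fun hd => notstart τ p hp hd hp1, hp1⟩
        have k := bundle_class_two_type_count ends r L hL w e u b hw0 hwL harc hwinj hcross A hA hAdisj E hEA z q p hz hq hp hzq hzp hpq.symm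
          a ha1 haL 𝒱 hV ha hb ka kb mha mhb mka mkb ha01 hb01 ka01 kb01 hT₁ hT₂
        convert k using 3
      · -- type 1 does not start red on p: type 2 does; type 1 has p blue and starts red on q, type 2 has q blue
        have hp2 : e p 1 ∈ σ₂ := by
          by_contra hn
          exact claim p q hp hq hzp.symm hzq.symm hpq hr3 σ₁ σ₂ h1E h2E hcl1 hcl2 hs1 hs2 hA1 hn
        have hdq2 : Disjoint (A q) σ₂ := (face σ₂ h2E hcl2 hs2.2.1).resolve_left fun hd => notstart σ₂ p hp hd hp2
        have hT₁ : ∀ τ, τ ⊆ E → ((∀ j, 1 ≤ j → j ≤ a → e z j ∈ τ) ∧ e z (a + 1) ∉ τ) →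
            (𝒱 τ ∧ (b ∈ C (E \ τ) ∧ b ∉ C τ) ∧ (ha (C τ) = 1 ∧ hb (C (E \ τ)) = 0) ∧ (kb (C (E \ τ)) = 1 ∧ ka (C τ) = 0)) →
            Disjoint (A p) τ ∧ e q 1 ∈ τ := by
          intro τ hτ hclτ hsτ
          have hq1 : e q 1 ∈ τ := by
            by_contra hn
            exact claim q p hq hp hzq.symm hzp.symm hpq.symm hr3' τ σ₂ hτ h2E hclτ hcl2 hsτ hs2 hn (notstart σ₂ q hq hdq2)
          exact ⟨(face τ hτ hclτ hsτ.2.1).resolve_right fun hd => notstart τ q hq hd hq1, hq1⟩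
        have hT₂ : ∀ τ, τ ⊆ E → ((∀ j, 1 ≤ j → j ≤ a → e z j ∈ τ) ∧ e z (a + 1) ∉ τ) →
            (𝒱 τ ∧ (b ∈ C (E \ τ) ∧ b ∉ C τ) ∧ (ka (C τ) = 1 ∧ kb (C (E \ τ)) = 0) ∧ (hb (C (E \ τ)) = 1 ∧ ha (C τ) = 0)) →
            Disjoint (A q) τ ∧ e p 1 ∈ τ := by
          intro τ hτ hclτ hsτ
          have hp1 : e p 1 ∈ τ := by
            by_contra hn
            exact claim p q hp hq hzp.symm hzq.symm hpq hr3 σ₁ τ h1E hτ hcl1 hclτ hs1 hsτ hA1 hn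
          exact ⟨(face τ hτ hclτ hsτ.2.1).resolve_left fun hd => notstart τ p hp hd hp1, hp1⟩
        have k := bundle_class_two_type_count ends r L hL w e u b hw0 hwL harc hwinj hcross A hA hAdisj E hEA z p q hz hp hq hzp hzq hpq
          a ha1 haL 𝒱 hV ha hb ka kb mha mhb mka mkb ha01 hb01 ka01 kb01 hT₁ hT₂
        convert k using 3
    · -- ## no type-2 source in the class: the merged scheme for type 1
      have h0 : (E.powerset).filter (fun σ => ((∀ j, 1 ≤ j → j ≤ a → e z j ∈ σ) ∧ e z (a + 1) ∉ σ) ∧ 𝒱 σ ∧ (b ∈ C (E \ σ) ∧ b ∉ C σ) ∧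
          (ka (C σ) = 1 ∧ kb (C (E \ σ)) = 0) ∧ (hb (C (E \ σ)) = 1 ∧ ha (C σ) = 0)) = ∅ := by
        apply Finset.filter_eq_empty_iff.mpr
        intro σ hσ hs
        exact h2 ⟨σ, Finset.mem_powerset.mp hσ, hs.1, hs.2⟩
      have h0' : ((E.powerset).filter (fun σ => ((∀ j, 1 ≤ j → j ≤ a → e z j ∈ σ) ∧ e z (a + 1) ∉ σ) ∧ 𝒱 σ ∧
          (b ∈ openCluster (ends '' (↑(E \ σ) : Set ι)) u ∧ b ∉ openCluster (ends '' (↑σ : Set ι)) u) ∧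
          (ka (openCluster (ends '' (↑σ : Set ι)) u) = 1 ∧ kb (openCluster (ends '' (↑(E \ σ) : Set ι)) u) = 0) ∧
          (hb (openCluster (ends '' (↑(E \ σ) : Set ι)) u) = 1 ∧ ha (openCluster (ends '' (↑σ : Set ι)) u) = 0))).card = 0 := by
        rw [Finset.card_eq_zero]; convert h0 using 3
      have m₁'' : ((E.powerset).filter (fun σ => ((∀ j, 1 ≤ j → j ≤ a → e z j ∈ σ) ∧ e z (a + 1) ∉ σ) ∧ 𝒱 σ ∧
          (b ∈ openCluster (ends '' (↑(E \ σ) : Set ι)) u ∧ b ∉ openCluster (ends '' (↑σ : Set ι)) u) ∧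
          (ha (openCluster (ends '' (↑σ : Set ι)) u) = 1 ∧ hb (openCluster (ends '' (↑(E \ σ) : Set ι)) u) = 0) ∧
          (kb (openCluster (ends '' (↑(E \ σ) : Set ι)) u) = 1 ∧ ka (openCluster (ends '' (↑σ : Set ι)) u) = 0))).card ≤
          ((E.powerset).filter (fun lam => ((∀ j, 1 ≤ j → j ≤ a → e z j ∈ lam) ∧ e z (a + 1) ∉ lam) ∧ 𝒱 lam ∧
          (b ∈ openCluster (ends '' (↑lam : Set ι)) u ∧ b ∉ openCluster (ends '' (↑(E \ lam) : Set ι)) u) ∧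
          ((ha (openCluster (ends '' (↑lam : Set ι)) u) = 1 ∧ kb (openCluster (ends '' (↑lam : Set ι)) u) = 1 ∧
              hb (openCluster (ends '' (↑(E \ lam) : Set ι)) u) = 0 ∧ ka (openCluster (ends '' (↑(E \ lam) : Set ι)) u) = 0) ∨
            (ka (openCluster (ends '' (↑lam : Set ι)) u) = 1 ∧ hb (openCluster (ends '' (↑lam : Set ι)) u) = 1 ∧
              kb (openCluster (ends '' (↑(E \ lam) : Set ι)) u) = 0 ∧ ha (openCluster (ends '' (↑(E \ lam) : Set ι)) u) = 0)))).card := by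
        convert le_trans m₁' cL₁ using 3
      omega
  · -- ## no type-1 source in the class: the merged scheme for type 2
    have h0 : (E.powerset).filter (fun σ => ((∀ j, 1 ≤ j → j ≤ a → e z j ∈ σ) ∧ e z (a + 1) ∉ σ) ∧ 𝒱 σ ∧ (b ∈ C (E \ σ) ∧ b ∉ C σ) ∧
        (ha (C σ) = 1 ∧ hb (C (E \ σ)) = 0) ∧ (kb (C (E \ σ)) = 1 ∧ ka (C σ) = 0)) = ∅ := by
      apply Finset.filter_eq_empty_iff.mpr
      intro σ hσ hs
      exact h1 ⟨σ, Finset.mem_powerset.mp hσ, hs.1, hs.2⟩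
    have h0' : ((E.powerset).filter (fun σ => ((∀ j, 1 ≤ j → j ≤ a → e z j ∈ σ) ∧ e z (a + 1) ∉ σ) ∧ 𝒱 σ ∧
        (b ∈ openCluster (ends '' (↑(E \ σ) : Set ι)) u ∧ b ∉ openCluster (ends '' (↑σ : Set ι)) u) ∧
        (ha (openCluster (ends '' (↑σ : Set ι)) u) = 1 ∧ hb (openCluster (ends '' (↑(E \ σ) : Set ι)) u) = 0) ∧
        (kb (openCluster (ends '' (↑(E \ σ) : Set ι)) u) = 1 ∧ ka (openCluster (ends '' (↑σ : Set ι)) u) = 0))).card = 0 := by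
      rw [Finset.card_eq_zero]; convert h0 using 3
    have m₂'' : ((E.powerset).filter (fun σ => ((∀ j, 1 ≤ j → j ≤ a → e z j ∈ σ) ∧ e z (a + 1) ∉ σ) ∧ 𝒱 σ ∧
        (b ∈ openCluster (ends '' (↑(E \ σ) : Set ι)) u ∧ b ∉ openCluster (ends '' (↑σ : Set ι)) u) ∧
        (ka (openCluster (ends '' (↑σ : Set ι)) u) = 1 ∧ kb (openCluster (ends '' (↑(E \ σ) : Set ι)) u) = 0) ∧
        (hb (openCluster (ends '' (↑(E \ σ) : Set ι)) u) = 1 ∧ ha (openCluster (ends '' (↑σ : Set ι)) u) = 0))).card ≤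
        ((E.powerset).filter (fun lam => ((∀ j, 1 ≤ j → j ≤ a → e z j ∈ lam) ∧ e z (a + 1) ∉ lam) ∧ 𝒱 lam ∧
        (b ∈ openCluster (ends '' (↑lam : Set ι)) u ∧ b ∉ openCluster (ends '' (↑(E \ lam) : Set ι)) u) ∧
        ((ha (openCluster (ends '' (↑lam : Set ι)) u) = 1 ∧ kb (openCluster (ends '' (↑lam : Set ι)) u) = 1 ∧
            hb (openCluster (ends '' (↑(E \ lam) : Set ι)) u) = 0 ∧ ka (openCluster (ends '' (↑(E \ lam) : Set ι)) u) = 0) ∨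
          (ka (openCluster (ends '' (↑lam : Set ι)) u) = 1 ∧ hb (openCluster (ends '' (↑lam : Set ι)) u) = 1 ∧
            kb (openCluster (ends '' (↑(E \ lam) : Set ι)) u) = 0 ∧ ha (openCluster (ends '' (↑(E \ lam) : Set ι)) u) = 0)))).card := by
      convert le_trans m₂' cL₂ using 3
    omega

end Coefficientwise

end Summit.CriticalPhenomena.PercolationContinuityZ3.Theorems
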